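import Mathlib
import Summits.KontsevichZagierPeriods.Statement
import Literature.NumberTheory.Transcendental.Sweep1

/-!
# KontsevichZagierPeriods / NoriTransfer — refutations

Problem `KontsevichZagierPeriods`, topic `NoriTransfer`. The route thesis
stmt-KontsevichZagierPeriods-0190 asks for an *additive* transfer map
`Φ : Literature.Periods.FreePeriodSymbols R σ →+ Literature.KZ.FormalRep` with the section property
`∀ n (r : IntegralRep n), r.IsRational → ∃ x, Φ x - [r] ∈ KZ.relations ∧ …`.
But `FreePeriodSymbols R σ = (PeriodSymbol R σ →₀ ℚ̄)` is a `ℚ`-vector space (a divisible group)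
while `KZ.FormalRep` is a free abelian group, so every such `Φ` is `0`; the section property then
forces `[r] ∈ KZ.relations` for every rational representation `r`, in particular for
`∫_{ℝ⁰} 1 = 1`, contradicting the soundness of the calculus (`Literature.NumberTheory.Transcendental.KZ.relations_le_ker_eval`, a
named fact). Hence, modulo that named fact, the thesis as typed is false for *every* period datum
`(P, R, B, σ)`, independently of Kontsevich's formal period conjecture. The datum-specific
corollary `¬ (∃ P R B σ, … ∧ ∃ Φ, …)` is the three-line consequence
`rintro ⟨P, R, B, σ, -, Φ, -, hsec⟩; exact no_additive_transfer_section hs Φ (fun n r hr =>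
(hsec n r hr).imp fun x hx => hx.1)`, recorded below as `not_nori_thesis`.
[Kontsevich–Zagier 2001, §1.2; Huber–Müller-Stach 2017, §13.1]
-/

namespace Summit.KontsevichZagierPeriods.NoriTransfer

open Literature.NumberTheory.Transcendental Literature.ModelTheory.ExponentialFields

/-- Refutes the transfer clause of stmt-KontsevichZagierPeriods-0190 (route NoriTransfer thesis)
for every source that is a `ℚ`-module, modulo soundness of the KZ calculus: there is no additive
`Φ : M →+ KZ.FormalRep` from a `ℚ`-module `M` such that every rational integral representation
`r` has some `x` with `Φ x - [r] ∈ KZ.relations`. Proof: an additive map from a divisible group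
to a free abelian group is `0` (each `ℤ`-coordinate of `Φ x` is divisible by every positive
integer), so `[r₁] ∈ relations` for the constant representation `r₁ = ∫_{ℝ⁰} 1 / 1` of value `1`,
whence `1 = eval [r₁] = 0`. In the thesis `M = FreePeriodSymbols R σ = (PeriodSymbol R σ →₀ ℚ̄)`,
so the thesis is false for every datum `(P, R, B, σ)`. Fix for the planner: type `Φ` on an
integral form of the symbol group (free abelian group on `PeriodSymbol R σ`, relators taken
integrally), or drop `Φ` and state the transfer pointwise on pairs of rational representations.
[folklore] -/
theorem no_additive_transfer_section (hs : KZ.relations_le_ker_eval)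
    {M : Type*} [AddCommGroup M] [Module ℚ M] (Φ : M →+ KZ.FormalRep) :
    ¬ ∀ (n : ℕ) (r : KZ.IntegralRep n), r.IsRational → ∃ x, Φ x - KZ.of r ∈ KZ.relations := by
  -- (1) additive maps from a `ℚ`-module to `ℤ` vanish
  have hint : ∀ h : M →+ ℤ, h = 0 := by
    intro h
    ext x
    set N : ℕ := (h x).natAbs + 1 with hN
    have hN0 : (N : ℚ) ≠ 0 := by positivity
    have hx : x = (N : ℤ) • ((N : ℚ)⁻¹ • x) := by
      rw [← Int.cast_smul_eq_zsmul ℚ, smul_smul]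
      simp [hN0]
    have hdvd : (N : ℤ) ∣ h x := ⟨h ((N : ℚ)⁻¹ • x), by
      conv_lhs => rw [hx]
      rw [map_zsmul, smul_eq_mul]⟩
    have hlt : (h x).natAbs < (N : ℤ).natAbs := by
      rw [Int.natAbs_natCast, hN]; exact Nat.lt_succ_self _
    simpa using Int.eq_zero_of_dvd_of_natAbs_lt_natAbs hdvd hlt
  -- (2) hence additive maps from a `ℚ`-module to a free abelian group vanish
  have hΦ : Φ = 0 := by
    ext x
    apply (FreeAbelianGroup.equivFinsupp _).injective
    rw [AddMonoidHom.zero_apply, map_zero]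
    ext a
    have := hint
      ((Finsupp.applyAddHom a).comp ((FreeAbelianGroup.equivFinsupp _).toAddMonoidHom.comp Φ))
    simpa using DFunLike.congr_fun this x
  -- (3) the constant representation `∫_{ℝ⁰} 1 / 1`, rational, of value `1`
  let r₁ : KZ.IntegralRep 0 :=
    KZ.IntegralRep.ofRational Set.univ 1 1 isSemialgebraic_univ (fun _ _ => by simp) (by simp)
  have hr₁ : r₁.IsRational := KZ.IntegralRep.isRational_ofRational _ _ _ _ _ _
  have hv₁ : r₁.value = 1 := by
    simp only [r₁, KZ.IntegralRep.value_ofRational]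
    simp [MeasureTheory.Measure.real, MeasureTheory.volume_pi]
  -- (4) contradiction with soundness
  intro hsec
  obtain ⟨x, hx⟩ := hsec 0 r₁ hr₁
  rw [hΦ, AddMonoidHom.zero_apply, zero_sub, neg_mem_iff] at hx
  have h0 : KZ.eval (KZ.of r₁) = 0 := hs hx
  rw [KZ.eval_of, hv₁] at h0
  exact one_ne_zero h0

/-- Refutes stmt-KontsevichZagierPeriods-0190 (route NoriTransfer thesis) as typed, modulo the
named fact `KZ.relations_le_ker_eval` (soundness of the KZ calculus): no period datum
`(P, R, B, σ)` admits an *additive* transfer `Φ : FreePeriodSymbols R σ →+ KZ.FormalRep` with the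
section property, because `FreePeriodSymbols R σ = (PeriodSymbol R σ →₀ ℚ̄)` is a `ℚ`-vector space
and `KZ.FormalRep` is free abelian, so `Φ = 0`
(`no_additive_transfer_section`); Kontsevich's formal period conjecture plays no role.
Fix for the planner: define `Φ` on the free abelian group on `PeriodSymbol R σ`. [folklore] -/
theorem not_nori_thesis (hs : KZ.relations_le_ker_eval) :
    ¬ ∃ (P : Literature.AlgebraicGeometry.Motives.PeriodRealization (AlgebraicClosure ℚ)) (R : Literature.AlgebraicGeometry.Motives.RelativePeriodData P)
        (B : R.BoundaryData) (σ : AlgebraicClosure ℚ →+* ℂ),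
      Literature.NumberTheory.Transcendental.KontsevichPeriodConjecture R B σ ∧
        ∃ Φ : Literature.NumberTheory.Transcendental.FreePeriodSymbols R σ →+ Literature.NumberTheory.Transcendental.KZ.FormalRep,
          (∀ x ∈ Literature.NumberTheory.Transcendental.formalPeriodRelations R B σ, Φ x ∈ Literature.NumberTheory.Transcendental.KZ.relations) ∧
          (∀ (n : ℕ) (r : Literature.NumberTheory.Transcendental.KZ.IntegralRep n), r.IsRational →
            ∃ x, Φ x - Literature.NumberTheory.Transcendental.KZ.of r ∈ Literature.NumberTheory.Transcendental.KZ.relations ∧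
              Literature.AlgebraicGeometry.Motives.AlongHom.equiv σ (Literature.NumberTheory.Transcendental.formalPeriodEval R σ x) = (r.value : ℂ)) := by
  rintro ⟨P, R, B, σ, -, Φ, -, hsec⟩
  exact no_additive_transfer_section hs Φ (fun n r hr => (hsec n r hr).imp fun x hx => hx.1)

end Summit.KontsevichZagierPeriods.NoriTransfer
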